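import Mathlib.MeasureTheory.Integral.Bochner.Basic
import Mathlib.Analysis.SpecialFunctions.Pow.Real
import Literature.Geometry.Lorentzian.LeviCivita
import Literature.Geometry.Lorentzian.Volume
import HarnessLib

/-!
# The Yamabe constant of a conformal class

Definitions (real, with bodies; NO named facts — this file is meant to sit in the import cone of
routes, like `WeylEnergy.lean`) requested as `defn-yamabeConstant` by route
SmoothPoincare4/EinsteinBulk (items `YamabePinchedEinsteinBulk`, `PEFillNearRound`,
`YamabeExtremalSpheres`, `PEFilledHomotopySpheres`; cards yamabe-extremal-or-thin,
bach-critical-element; route BachCriticalElement), over the metric vocabulary of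
`Literature/Geometry/Lorentzian`: a `C^n` Riemannian metric
`h : Bundle.ContMDiffRiemannianMetric I n E (TangentSpace I : M → Type _)` on `TM`, its
pseudo-Riemannian metric `PseudoRiemannianMetric.ofRiemannian h` with Levi-Civita connection
(standing instance hypothesis `[(ofRiemannian h).HasLeviCivita]`, `LeviCivita.lean`) and scalar
curvature `scalarCurvature`, and its Riemannian measure `dV_h = riemannianMeasure h`
(`Volume.lean`).

* `IsConformalTo h g` — `h` and `g` are (pointwise) CONFORMAL: `h_x = φ(x) g_x` for a positive
  function `φ : M → ℝ` (for `C^n` metrics `φ = h(v,v)/g(v,v)` is automatically `C^n`); an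
  equivalence relation (`IsConformalTo.refl/symm/trans`), whose classes are the conformal classes
  `[g]`.  This is literally the relation the route's items inline
  (`∃ φ, ∀ x, 0 < φ x ∧ ∀ v w, h.inner x v w = φ x * g.inner x v w`).
* `totalScalarCurvature h = ∫_M R_h dV_h` — the (unnormalised) Einstein–Hilbert functional.
* `yamabeQuotient h = (∫_M R_h dV_h) / Vol(M,h)^{(m-2)/m}`, `m = dim M = finrank ℝ E` — the value
  of the Yamabe functional at the metric `h` (Lee–Parker 1987, §1: `Q(g̃) = E(φ)/‖φ‖²_p` for
  `g̃ = φ^{p-2} g`, `p = 2m/(m-2)`, `2/p = (m-2)/m`; for `m = 4` the exponent is `1/2`,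
  `yamabeQuotient_eq_div_sqrt`).
* `yamabeConstant g₀ = Y(M,[g₀]) = inf { yamabeQuotient h : h ∈ [g₀] }` — THE YAMABE CONSTANT of
  the conformal class of `g₀` (Lee–Parker 1987, (1.5), the "Yamabe invariant `λ(M)`" of `(M,g₀)`;
  Chang–Gursky–Yang 2003, Remark 1 after Thm. A, verbatim for `m = 4`:
  `Y(M⁴,g) = inf_{g̃ ∈ [g]} vol(g̃)^{-1/2} ∫_{M⁴} R_{g̃} dvol_{g̃}`), as a real `sInf`.

API (all proved): `yamabeConstant_le` (every conformal metric bounds `Y` from above, given that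
the functional is bounded below on the class — `λ(M) > -∞`, Lee–Parker 1987, §1 after (1.5), a
hypothesis here), `le_yamabeConstant` (a uniform lower bound for the quotients of all conformal metrics bounds
`Y` from below), `yamabeConstant_eq_of_isConformalTo` (CONFORMAL INVARIANCE: `Y` depends only on
the class), and the dictionary with the inline form of the route's items in dimension `4`:
`le_yamabeQuotient_iff_mul_sqrt_le` (`λ ≤ Q(h) ↔ λ √Vol(h) ≤ ∫ R_h dV_h` when `Vol(h) > 0`) and
`le_yamabeConstant_of_forall_mul_sqrt_le`.

## Design notes

* Measurable structure as instance arguments `[MeasurableSpace M] [BorelSpace M]` (as for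
  `riemannianMeasure` and the route's binders), `[T3Space M]` for the length-metric construction
  of the measure (automatic on compact Hausdorff, or Hausdorff finite-dimensional, manifolds).
* `HasLeviCivita` is a `Prop`-valued standing hypothesis of the curvature API; the index set of
  the infimum therefore quantifies `∃ h, ∃ _ : (ofRiemannian h).HasLeviCivita, …` (the bound
  hypothesis serves as the instance, exactly as in `ChangGurskyYang.lean`).  Mathematically every
  `C^n` metric, `n ≥ 1`, has its Levi-Civita connection (named fact
  `isCovariantDerivativeOn_leviCivitaFun` of `LeviCivita.lean`), so this is no restriction.
* JUNK VALUES of the real `sInf`: `0` if the index set is empty (it is not once `g₀` has its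
  Levi-Civita connection: `g₀ ∈ [g₀]`) or not bounded below (it always is: `Y(M,[g]) > -∞`,
  Lee–Parker 1987, §1 — not proved here, hence the `BddBelow` hypotheses).
  `Vol(M,h)^{(m-2)/m}` is a real power `Real.rpow` of `(riemannianMeasure h univ).toReal` (junk `0`
  for infinite volume; closed manifolds have finite positive volume); for `m ≤ 2` the exponent is
  `≤ 0` (the Yamabe problem is posed for `m ≥ 3`).
* What is NOT here: the function form `inf_φ E(φ)/‖φ‖²_p` of `λ(M)` and its agreement with the
  metric form (needs the conformal transformation law of `R` in dimension `m`; the tree proves it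
  for `m = 3`, `ConformalChange.lean`), Aubin's `Y(M,[g]) ≤ Y(Sᵐ,[round])` with
  `Y(S⁴) = 8√6 π`, the solution of the Yamabe problem, the smooth Yamabe invariant
  `σ(M) = sup_{[g]} Y(M,[g])` — facts/definitions for separate requests.

## References

* J. M. Lee, T. H. Parker, *The Yamabe problem*, Bull. AMS 17 (1987) 37–91, §1, (1.5) (the
  invariant `λ(M)`). [LeeParker1987]
* S.-Y. A. Chang, M. J. Gursky, P. C. Yang, *A conformally invariant sphere theorem in four
  dimensions*, Publ. Math. IHÉS 98 (2003), arXiv:math/0309287, Remark 1 after Thm. A.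
  [ChangGurskyYang2003]
-/

noncomputable section

open Bundle MeasureTheory Set
open scoped Manifold ContDiff Topology ENNReal

namespace Literature.Geometry.Riemannian

open Literature.Geometry.Lorentzian (PseudoRiemannianMetric riemannianMeasure)
open Literature.Geometry.Lorentzian.PseudoRiemannianMetric

variable {E : Type*} [NormedAddCommGroup E] [NormedSpace ℝ E] {H : Type*} [TopologicalSpace H]
  {I : ModelWithCorners ℝ E H} {M : Type*} [TopologicalSpace M] [ChartedSpace H M]
  [IsManifold I ∞ M] {n : ℕ∞ω}

/-! ### Conformal metrics -/

/-- The Riemannian metrics `h` and `g` on `TM` are (pointwise) CONFORMAL, `h ∈ [g]`: there is a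
positive function `φ : M → ℝ` with `h_x(v, w) = φ(x) g_x(v, w)` for all `x`, `v`, `w` (for `C^n`
metrics `φ` is then `C^n`, being a quotient of the two quadratic forms).  Literally the relation
inlined by the items of route SmoothPoincare4/EinsteinBulk. (Lee–Parker 1987, §1: "`g̃` is
conformal to `g` if `g̃ = e^{2f} g`".) [cite: LeeParker1987, §1] -/
def IsConformalTo (h g : ContMDiffRiemannianMetric I n E (TangentSpace I : M → Type _)) : Prop :=
  ∃ φ : M → ℝ, ∀ x : M, 0 < φ x ∧ ∀ v w : TangentSpace I x, h.inner x v w = φ x * g.inner x v w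

namespace IsConformalTo

variable {h g k : ContMDiffRiemannianMetric I n E (TangentSpace I : M → Type _)}

/-- Every metric is conformal to itself (`φ = 1`). [cite: LeeParker1987, §1] -/
protected theorem refl (g : ContMDiffRiemannianMetric I n E (TangentSpace I : M → Type _)) :
    IsConformalTo g g :=
  ⟨fun _ => 1, fun _ => ⟨one_pos, fun _ _ => (one_mul _).symm⟩⟩

/-- Conformality is symmetric (`φ ↦ φ⁻¹`). [cite: LeeParker1987, §1] -/
protected theorem symm (hc : IsConformalTo h g) : IsConformalTo g h := by
  obtain ⟨φ, hφ⟩ := hc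
  refine ⟨fun x => (φ x)⁻¹, fun x => ⟨inv_pos.2 (hφ x).1, fun v w => ?_⟩⟩
  rw [(hφ x).2 v w, ← mul_assoc, inv_mul_cancel₀ (hφ x).1.ne', one_mul]

/-- Conformality is transitive (`φ ↦ φ ψ`). [cite: LeeParker1987, §1] -/
protected theorem trans (hhg : IsConformalTo h g) (hgk : IsConformalTo g k) :
    IsConformalTo h k := by
  obtain ⟨φ, hφ⟩ := hhg
  obtain ⟨ψ, hψ⟩ := hgk
  refine ⟨fun x => φ x * ψ x, fun x => ⟨mul_pos (hφ x).1 (hψ x).1, fun v w => ?_⟩⟩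
  rw [(hφ x).2 v w, (hψ x).2 v w, mul_assoc]

end IsConformalTo

/-- `h ∈ [g] ↔ g ∈ [h]`. [cite: LeeParker1987, §1] -/
theorem isConformalTo_comm {h g : ContMDiffRiemannianMetric I n E (TangentSpace I : M → Type _)} :
    IsConformalTo h g ↔ IsConformalTo g h :=
  ⟨IsConformalTo.symm, IsConformalTo.symm⟩

/-- Two metrics in the same conformal class have the same conformal class:
`h ∈ [g₀] → ([k ∈ [h]] ↔ [k ∈ [g₀]])`. [cite: LeeParker1987, §1] -/
theorem IsConformalTo.isConformalTo_iff
    {h g₀ : ContMDiffRiemannianMetric I n E (TangentSpace I : M → Type _)} (hc : IsConformalTo h g₀)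
    (k : ContMDiffRiemannianMetric I n E (TangentSpace I : M → Type _)) :
    IsConformalTo k h ↔ IsConformalTo k g₀ :=
  ⟨fun hk => hk.trans hc, fun hk => hk.trans hc.symm⟩

/-! ### The Yamabe functional of a metric and the Yamabe constant of a conformal class -/

section Yamabe

variable [FiniteDimensional ℝ E] [T3Space M] [MeasurableSpace M] [BorelSpace M]

/-- The TOTAL SCALAR CURVATURE `∫_M R_h dV_h` of the Riemannian metric `h` (the Einstein–Hilbert
functional; the numerator of the Yamabe functional): the Bochner integral of the scalar curvature
of `ofRiemannian h` (with its Levi-Civita connection) against the Riemannian measure of `h`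
(junk `0` if `R_h` is not integrable, e.g. on a non-compact manifold). [cite: LeeParker1987, §1] -/
def totalScalarCurvature (h : ContMDiffRiemannianMetric I n E (TangentSpace I : M → Type _))
    [(ofRiemannian h).HasLeviCivita] : ℝ :=
  ∫ x, (ofRiemannian h).scalarCurvature x ∂(riemannianMeasure h)

/-- The YAMABE QUOTIENT (value of the Yamabe functional) of the metric `h` on the `m`-manifold
`M`, `m = finrank ℝ E`: `Q(h) = (∫_M R_h dV_h) / Vol(M,h)^{(m-2)/m}` (real power `Real.rpow` of
the total volume `(riemannianMeasure h univ).toReal`).  Lee–Parker 1987, §1 (`Q(φ^{p-2}g) =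
E(φ)/‖φ‖_p²`, `2/p = (m-2)/m`); Chang–Gursky–Yang 2003, Remark 1 (`m = 4`:
`vol(g̃)^{-1/2} ∫ R_{g̃} dvol_{g̃}`, see `yamabeQuotient_eq_div_sqrt`).
[cite: LeeParker1987, §1, (1.5)] -/
def yamabeQuotient (h : ContMDiffRiemannianMetric I n E (TangentSpace I : M → Type _))
    [(ofRiemannian h).HasLeviCivita] : ℝ :=
  totalScalarCurvature h /
    (riemannianMeasure h univ).toReal ^ (((Module.finrank ℝ E : ℝ) - 2) / Module.finrank ℝ E)

/-- The index set of the Yamabe constant of `[g₀]`: the Yamabe quotients of the `C^n` Riemannian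
metrics conformal to `g₀` (each with its Levi-Civita connection, the bound hypothesis serving as
the instance). [cite: LeeParker1987, §1, (1.5)] -/
def yamabeQuotients (g₀ : ContMDiffRiemannianMetric I n E (TangentSpace I : M → Type _)) : Set ℝ :=
  {q | ∃ (h : ContMDiffRiemannianMetric I n E (TangentSpace I : M → Type _))
    (_ : (ofRiemannian h).HasLeviCivita), IsConformalTo h g₀ ∧ yamabeQuotient h = q}

/-- **The Yamabe constant `Y(M,[g₀])` of the conformal class of `g₀`**:
`Y(M,[g₀]) = inf { (∫_M R_h dV_h) / Vol(M,h)^{(m-2)/m} : h conformal to g₀ }`, `m = dim M`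
(Lee–Parker 1987, (1.5): the Yamabe invariant `λ(M)` of `(M, g₀)`, in its metric form;
Chang–Gursky–Yang 2003, Remark 1 after Thm. A, verbatim for `m = 4`:
"`Y(M⁴,g) = inf_{g̃ ∈ [g]} vol(g̃)^{-1/2} ∫_{M⁴} R_{g̃} dvol_{g̃}`, where `[g]` denotes the
conformal class of `g`").  A real `sInf`: junk value `0` if the index set `yamabeQuotients g₀`
were empty or unbounded below (neither happens for a `C^n` metric on a closed manifold, `m ≥ 3`:
`g₀ ∈ [g₀]` and `Y > -∞`, Lee–Parker 1987, §1).  Conformally invariant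
(`yamabeConstant_eq_of_isConformalTo`).
[cite: LeeParker1987, §1, (1.5)] [cite: ChangGurskyYang2003, Remark 1] -/
def yamabeConstant (g₀ : ContMDiffRiemannianMetric I n E (TangentSpace I : M → Type _)) : ℝ :=
  sInf (yamabeQuotients g₀)

variable {g₀ : ContMDiffRiemannianMetric I n E (TangentSpace I : M → Type _)}

/-- Membership in the index set, unfolded. [cite: LeeParker1987, §1, (1.5)] -/
theorem mem_yamabeQuotients_iff {q : ℝ} :
    q ∈ yamabeQuotients g₀ ↔ ∃ (h : ContMDiffRiemannianMetric I n E (TangentSpace I : M → Type _))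
      (_ : (ofRiemannian h).HasLeviCivita), IsConformalTo h g₀ ∧ yamabeQuotient h = q :=
  Iff.rfl

/-- The Yamabe quotient of a metric conformal to `g₀` belongs to the index set of `Y(M,[g₀])`.
[cite: LeeParker1987, §1, (1.5)] -/
theorem yamabeQuotient_mem_yamabeQuotients
    (h : ContMDiffRiemannianMetric I n E (TangentSpace I : M → Type _))
    [hLC : (ofRiemannian h).HasLeviCivita] (hc : IsConformalTo h g₀) :
    yamabeQuotient h ∈ yamabeQuotients g₀ :=
  ⟨h, hLC, hc, rfl⟩

/-- Unfolding: `Y(M,[g₀]) = sInf (yamabeQuotients g₀)`. [cite: LeeParker1987, §1, (1.5)] -/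
theorem yamabeConstant_eq_sInf
    (g₀ : ContMDiffRiemannianMetric I n E (TangentSpace I : M → Type _)) :
    yamabeConstant g₀ = sInf (yamabeQuotients g₀) :=
  rfl

/-- `Y(M,[g₀]) ≤ Q(h)` for every metric `h ∈ [g₀]`, provided the Yamabe functional is bounded
below on the class (always true, Lee–Parker 1987, §1; a hypothesis here). In particular
`Y(M,[g₀]) ≤ Q(g₀)`. [cite: LeeParker1987, §1, (1.5)] -/
theorem yamabeConstant_le (hbdd : BddBelow (yamabeQuotients g₀))
    (h : ContMDiffRiemannianMetric I n E (TangentSpace I : M → Type _))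
    [(ofRiemannian h).HasLeviCivita] (hc : IsConformalTo h g₀) :
    yamabeConstant g₀ ≤ yamabeQuotient h :=
  csInf_le hbdd (yamabeQuotient_mem_yamabeQuotients h hc)

/-- A uniform lower bound for the Yamabe quotients of all metrics conformal to `g₀` is a lower
bound for `Y(M,[g₀])` (the class being non-empty as soon as `g₀` carries its Levi-Civita
connection: `g₀ ∈ [g₀]`). [cite: LeeParker1987, §1, (1.5)] -/
theorem le_yamabeConstant [(ofRiemannian g₀).HasLeviCivita] {c : ℝ}
    (hc : ∀ (h : ContMDiffRiemannianMetric I n E (TangentSpace I : M → Type _))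
      [(ofRiemannian h).HasLeviCivita], IsConformalTo h g₀ → c ≤ yamabeQuotient h) :
    c ≤ yamabeConstant g₀ := by
  refine le_csInf ⟨_, yamabeQuotient_mem_yamabeQuotients g₀ (IsConformalTo.refl g₀)⟩ ?_
  rintro q ⟨h, hLC, hhc, rfl⟩
  exact hc h hhc

/-- `Y(M,[g₀]) ≤ c` as soon as some metric of the class has quotient `≤ c` (functional bounded
below on the class). [cite: LeeParker1987, §1, (1.5)] -/
theorem yamabeConstant_le_of_le (hbdd : BddBelow (yamabeQuotients g₀)) {c : ℝ}
    (h : ContMDiffRiemannianMetric I n E (TangentSpace I : M → Type _))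
    [(ofRiemannian h).HasLeviCivita] (hc : IsConformalTo h g₀) (hq : yamabeQuotient h ≤ c) :
    yamabeConstant g₀ ≤ c :=
  (yamabeConstant_le hbdd h hc).trans hq

/-- CONFORMAL INVARIANCE: metrics in the same conformal class have the same index set of
quotients … [cite: LeeParker1987, §1, (1.5)] -/
theorem yamabeQuotients_eq_of_isConformalTo
    {g₁ g₀ : ContMDiffRiemannianMetric I n E (TangentSpace I : M → Type _)}
    (hc : IsConformalTo g₁ g₀) : yamabeQuotients g₁ = yamabeQuotients g₀ := by
  ext q
  simp only [mem_yamabeQuotients_iff, hc.isConformalTo_iff]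

/-- … hence the same Yamabe constant: `Y(M,[g₁]) = Y(M,[g₀])` for `g₁ ∈ [g₀]` — `Y` is an
invariant of the conformal class. [cite: LeeParker1987, §1, (1.5)] -/
theorem yamabeConstant_eq_of_isConformalTo
    {g₁ g₀ : ContMDiffRiemannianMetric I n E (TangentSpace I : M → Type _)}
    (hc : IsConformalTo g₁ g₀) : yamabeConstant g₁ = yamabeConstant g₀ := by
  rw [yamabeConstant, yamabeConstant, yamabeQuotients_eq_of_isConformalTo hc]

/-! ### Dimension four: `Q(h) = Vol(h)^{-1/2} ∫ R_h dV_h` and the route's inline form -/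

/-- In dimension `m = 4` the normalising exponent `(m-2)/m` is `1/2`:
`Q(h) = (∫_M R_h dV_h) / √Vol(M,h)` (Chang–Gursky–Yang 2003, Remark 1).
[cite: ChangGurskyYang2003, Remark 1] -/
theorem yamabeQuotient_eq_div_sqrt (hE : Module.finrank ℝ E = 4)
    (h : ContMDiffRiemannianMetric I n E (TangentSpace I : M → Type _))
    [(ofRiemannian h).HasLeviCivita] :
    yamabeQuotient h = totalScalarCurvature h / Real.sqrt (riemannianMeasure h univ).toReal := by
  rw [yamabeQuotient, hE, Real.sqrt_eq_rpow]
  norm_num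

/-- The dictionary with the inline form of the items of route SmoothPoincare4/EinsteinBulk: in
dimension `4`, for a metric of positive (finite) volume, `λ ≤ Q(h) ↔ λ · √Vol(M,h) ≤ ∫_M R_h dV_h`.
[cite: ChangGurskyYang2003, Remark 1] -/
theorem le_yamabeQuotient_iff_mul_sqrt_le (hE : Module.finrank ℝ E = 4)
    (h : ContMDiffRiemannianMetric I n E (TangentSpace I : M → Type _))
    [(ofRiemannian h).HasLeviCivita] (hvol : 0 < (riemannianMeasure h univ).toReal) (c : ℝ) :
    c ≤ yamabeQuotient h ↔
      c * Real.sqrt (riemannianMeasure h univ).toReal ≤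
        ∫ x, (ofRiemannian h).scalarCurvature x ∂(riemannianMeasure h) := by
  rw [yamabeQuotient_eq_div_sqrt hE, le_div_iff₀ (Real.sqrt_pos.2 hvol)]
  rfl

/-- The route's inline hypothesis "`λ √Vol(h) ≤ ∫ R_h dV_h` for every `h ∈ [g₀]`" gives
`λ ≤ Y(M,[g₀])` in dimension `4`, provided every metric of the class has positive finite volume
(true on a closed manifold) and `g₀` carries its Levi-Civita connection.
[cite: ChangGurskyYang2003, Remark 1] -/
theorem le_yamabeConstant_of_forall_mul_sqrt_le (hE : Module.finrank ℝ E = 4)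
    [(ofRiemannian g₀).HasLeviCivita] {c : ℝ}
    (hvol : ∀ (h : ContMDiffRiemannianMetric I n E (TangentSpace I : M → Type _)),
      IsConformalTo h g₀ → 0 < (riemannianMeasure h univ).toReal)
    (hc : ∀ (h : ContMDiffRiemannianMetric I n E (TangentSpace I : M → Type _))
      [(ofRiemannian h).HasLeviCivita], IsConformalTo h g₀ →
        c * Real.sqrt (riemannianMeasure h univ).toReal ≤
          ∫ x, (ofRiemannian h).scalarCurvature x ∂(riemannianMeasure h)) :
    c ≤ yamabeConstant g₀ :=
  le_yamabeConstant fun h _ hhc =>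
    (le_yamabeQuotient_iff_mul_sqrt_le hE h (hvol h hhc) c).2 (hc h hhc)

end Yamabe

end Literature.Geometry.Riemannian

end
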